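import Mathlib
import HarnessLib
import Summits.HubbardSuperconductivity.HubbardSuperconductivity.Theorems.KLProgrammePerturbedFermiCurveGaussMapRateHess
import Summits.HubbardSuperconductivity.HubbardSuperconductivity.Theorems.KLProgrammeH10TwoPointLimitPerturbedFermiRadiusSecondOrder
import Summits.HubbardSuperconductivity.HubbardSuperconductivity.Theorems.KLProgrammeH10TwoPointLimitFramePerturbation
import Summits.HubbardSuperconductivity.HubbardSuperconductivity.Theorems.KLProgrammeFermiSurfaceFST2Regularity
import Literature.MathematicalPhysics.QuantumLattice.SectorSymbolMasterZero

/-!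
# Route `KLProgramme` — ENGINE child (stmt-HubbardSuperconductivity-20437 `KLRegimeEngineV17F2`): the frame band's first and second derivatives
# IN COORDINATES, the tangential-Hessian floor (H) from `FrameOK` (i), and the FRAME-UNIFORM Gauss-map rate of the frame's Fermi curve

Cell `gate-hubbard-kl`, seat hubbard-kl-k3c2-p2 g15; closes the bridge named in `…PerturbedFermiCurveGaussMapRateHess` (p605077) and in the design note
HOME/hubbard-kl-k3c2-p2/TWO-SHELL-FRAME-PORT.md §2.  For a frame `K : TrigPolyC4v`, `δ_K := fun k => −K.eval k` is p4's perturbation on `Fin 2 → ℝ` and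
`frameLevel μ K (toLp k) = ε₀(k) + δ_K(k) − μ` (`frameLevel_toLp`):
* §1 `fderiv_frameLevel_toLp` — `De_K(toLp p)[toLp v] = 2 sin p₀·v₀ + 2 sin p₁·v₁ + Dδ_K(p)[v]`;
  **`hessQuad_frameLevel_toLp`** — `(toLp v, e_K″(toLp p) toLp v) = 2cos p₀·v₀² + 2cos p₁·v₁² + D²δ_K(p)[v, v]` (fs-1's `klfs_iteratedFDeriv_two_e` + the chain rule
  through the linear `toLp`);
* §2 **`hessFloor_of_geomConstants`** — for any `C²` radius function `u` whose polar curve lies on the level-`ν` set of `ε₀ + δ_K` with `|ν − μ| < r₀`,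
  `GeomConstants (frameLevel μ K) Kc r₀ g₀ w` gives hypothesis (H) of `…GaussMapRateHess`:
  `w·(X_E′² + Y_E′²) ≤ 2cos X_E·X_E′² + 2cos Y_E·Y_E′² + D²δ_K(p)[v, v]` (tangency = p4's `levelIdentity_one`);
* §3 **`deriv_normalAngleFn_ge_of_geomConstants`**, **`normalAngleFn_expand_of_geomConstants`** — for a root selection `u` of the frame curve at level `ν`
  (p4's C⁰/C¹ binders `κ₀`, `κ₁ < Dt_min` only): `α′ ≥ u_min·w/(4 + κ₁)` and `(u_min·w/(4+κ₁))·|θ − θ′| ≤ |α(θ) − α(θ′)|` — the `BandBounds.gauss`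
  field of the frame's Fermi curve with a constant UNIFORM over all frames of `FrameOK` (i) (`w = 3/200`, `Kc = 7`): brick (T1)-input of the
  `TwoShellFrameAreaAt` witness (WITNESS-TARGETS-G11 §2).
Everything is PROVED; no definitions, no named facts; nothing asserts any stub or superconductivity.
References: FST II Lemma 2.1 [cite: FeldmanSalmhoferTrubowitz1998]; BGM 2003 §7.1 (A1.7)–(A1.10) [cite: BenfattoGiulianiMastropietro2003].
-/

noncomputable section

namespace Summit.HubbardSuperconductivity.HubbardSuperconductivity.Theorems.PerturbedFermiCurve

set_option linter.dupNamespace false -- summit = problem name (single-conjunct summit), D-0017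

open Real Set
open Literature.MathematicalPhysics.QuantumLattice Literature.MathematicalPhysics.QuantumLattice.BandSectorCounting
open Literature.MathematicalPhysics.QuantumLattice.FermiRG
open Summit.HubbardSuperconductivity.HubbardSuperconductivity.Theorems.DispersionFlow
open Summit.HubbardSuperconductivity.HubbardSuperconductivity.Theorems.KLRegimeSplit

/-! ## §1 The frame band's derivatives in coordinates -/

/-- The frame band through `toLp` is p4's perturbed dispersion: `e_K ∘ toLp = ε₀ + δ_K − μ`, `δ_K = −K.eval`. -/
theorem frameLevel_comp_toLp (μ : ℝ) (K : TrigPolyC4v) :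
    (frameLevel μ K) ∘ (fun k : Fin 2 → ℝ => (WithLp.toLp 2 k : Momentum)) = fun k => sqDispersion k + -K.eval k - μ := by
  funext k
  simp only [Function.comp_apply, frameLevel_toLp, frameShift_toLp]

/-- **First derivative of the frame band in coordinates**: `De_K(toLp p)[toLp v] = 2 sin p₀·v₀ + 2 sin p₁·v₁ + Dδ_K(p)[v]`. [folklore] -/
theorem fderiv_frameLevel_toLp (μ : ℝ) (K : TrigPolyC4v) (p v : Fin 2 → ℝ) :
    fderiv ℝ (frameLevel μ K) (WithLp.toLp 2 p) (WithLp.toLp 2 v) =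
      2 * Real.sin (p 0) * v 0 + 2 * Real.sin (p 1) * v 1 + fderiv ℝ (fun k : Fin 2 → ℝ => -K.eval k) p v := by
  set T : (Fin 2 → ℝ) →L[ℝ] Momentum := ((EuclideanSpace.equiv (Fin 2) ℝ).symm : (Fin 2 → ℝ) →L[ℝ] Momentum) with hT
  have hTapply : ∀ k : Fin 2 → ℝ, T k = WithLp.toLp 2 k := fun k => rfl
  -- the composite `e_K ∘ T` and its derivative by the chain rule
  have hcd : ContDiff ℝ 1 (frameLevel μ K) := by
    rw [frameLevel_eq_add]; exact (klfs_contDiff_e μ).add (contDiff_frameShift K)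
  have hdiff : DifferentiableAt ℝ (frameLevel μ K) (T p) := (hcd.differentiable one_ne_zero) _
  have hchain : fderiv ℝ (frameLevel μ K ∘ T) p = (fderiv ℝ (frameLevel μ K) (T p)).comp T :=
    (hdiff.hasFDerivAt.comp p T.hasFDerivAt).fderiv
  have happ : fderiv ℝ (frameLevel μ K) (T p) (T v) = fderiv ℝ (frameLevel μ K ∘ T) p v := by
    rw [hchain]; rfl
  rw [← hTapply p, ← hTapply v, happ]
  -- the composite is `ε₀ + δ_K − μ` on `Fin 2 → ℝ`
  have hcomp : frameLevel μ K ∘ T = fun k => sqDispersion k + -K.eval k - μ := by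
    funext k; simp only [Function.comp_apply, hTapply, frameLevel_toLp, frameShift_toLp]
  rw [hcomp]
  have hδ : DifferentiableAt ℝ (fun k : Fin 2 → ℝ => -K.eval k) p := (differentiable_frameShift_toLp K) p
  have hε : DifferentiableAt ℝ sqDispersion p := (contDiff_one_sqDispersion.differentiable (by norm_num)) p
  have hsum : HasFDerivAt (fun k : Fin 2 → ℝ => sqDispersion k + -K.eval k - μ)
      (fderiv ℝ sqDispersion p + fderiv ℝ (fun k : Fin 2 → ℝ => -K.eval k) p) p :=
    (hε.hasFDerivAt.add hδ.hasFDerivAt).sub_const μ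
  rw [hsum.fderiv, add_apply, fderiv_sqDispersion_apply]

/-- **The Hessian form of the frame band in coordinates**: `(toLp v, e_K″(toLp p)·toLp v) = 2cos p₀·v₀² + 2cos p₁·v₁² + D²δ_K(p)[v,v]`.
[cite: FeldmanSalmhoferTrubowitz1998, §2.2 (wpdef)] -/
theorem hessQuad_frameLevel_toLp (μ : ℝ) (K : TrigPolyC4v) (p v : Fin 2 → ℝ) :
    hessQuad (frameLevel μ K) (WithLp.toLp 2 p) (WithLp.toLp 2 v) =
      2 * Real.cos (p 0) * v 0 ^ 2 + 2 * Real.cos (p 1) * v 1 ^ 2 + fderiv ℝ (fderiv ℝ (fun k : Fin 2 → ℝ => -K.eval k)) p v v := by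
  set T : (Fin 2 → ℝ) →L[ℝ] Momentum := ((EuclideanSpace.equiv (Fin 2) ℝ).symm : (Fin 2 → ℝ) →L[ℝ] Momentum) with hT
  have hTapply : ∀ k : Fin 2 → ℝ, T k = WithLp.toLp 2 k := fun k => rfl
  rw [hessQuad, frameLevel_eq_add μ K]
  have he : ContDiff ℝ 2 (fun q : Momentum => squareDispersion 1 0 q - μ) := klfs_contDiff_e μ
  have hs : ContDiff ℝ 2 (frameShift K) := contDiff_frameShift K
  rw [iteratedFDeriv_add_apply he.contDiffAt hs.contDiffAt]
  rw [add_apply]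
  -- the free part (fs-1)
  rw [klfs_iteratedFDeriv_two_e]
  -- the frame part through the chain rule with `T`
  have hcomp : iteratedFDeriv ℝ 2 (frameShift K ∘ T) p = (iteratedFDeriv ℝ 2 (frameShift K) (T p)).compContinuousLinearMap fun _ => T :=
    T.iteratedFDeriv_comp_right hs p le_rfl
  have happ : iteratedFDeriv ℝ 2 (frameShift K) (T p) ![T v, T v] = iteratedFDeriv ℝ 2 (frameShift K ∘ T) p ![v, v] := by
    rw [hcomp, ContinuousMultilinearMap.compContinuousLinearMap_apply]
    congr 1
    funext i
    fin_cases i <;> rfl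
  have hfun : frameShift K ∘ T = fun k : Fin 2 → ℝ => -K.eval k := by
    funext k; simp only [Function.comp_apply, hTapply, frameShift_toLp]
  rw [← hTapply p, ← hTapply v, happ, hfun, iteratedFDeriv_two_apply]
  simp only [PiLp.toLp_apply, Matrix.cons_val_zero, Matrix.cons_val_one, Fin.isValue, hTapply]
  ring

/-! ## §2 The tangential-Hessian floor (H) from `GeomConstants` -/

/-- **(H) from the geometric constants of the frame**: for a `C²` radius function `u` whose polar curve lies on the level-`ν` set of `ε₀ + δ_K`
with `|ν − μ| < r₀`, `GeomConstants (frameLevel μ K) Kc r₀ g₀ w` gives `w·(X_E′² + Y_E′²) ≤ 2cos X_E·X_E′² + 2cos Y_E·Y_E′² + D²δ_K(p)[v,v]` at every angle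
(the tangent `v = (X_E′, Y_E′)` is `⊥ ∇e_K` by `levelIdentity_one`). [cite: FeldmanSalmhoferTrubowitz1998, Lemma 2.1] -/
theorem hessFloor_of_geomConstants {μ : ℝ} {K : TrigPolyC4v} {Kc r₀ g₀ w : ℝ} (hG : GeomConstants (frameLevel μ K) Kc r₀ g₀ w)
    {u : ℝ → ℝ} (hu2 : ContDiff ℝ 2 u) {ν : ℝ} (hroot : ∀ θ, sqDispersion (u θ • dir θ) + -K.eval (u θ • dir θ) = ν)
    (hν : |ν - μ| < r₀) (θ : ℝ) :
    w * (VXE u θ ^ 2 + VYE u θ ^ 2) ≤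
      2 * Real.cos (XE u θ) * VXE u θ ^ 2 + 2 * Real.cos (YE u θ) * VYE u θ ^ 2 +
        fderiv ℝ (fderiv ℝ (fun k : Fin 2 → ℝ => -K.eval k)) (u θ • dir θ) ![VXE u θ, VYE u θ] ![VXE u θ, VYE u θ] := by
  have hδ2 : ContDiff ℝ 2 (fun k : Fin 2 → ℝ => -K.eval k) := contDiff_frameShift_toLp K
  set p : Fin 2 → ℝ := u θ • dir θ with hp
  set v : Fin 2 → ℝ := ![VXE u θ, VYE u θ] with hv
  have hp0 : p 0 = XE u θ := by simp [hp, dir, XE]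
  have hp1 : p 1 = YE u θ := by simp [hp, dir, YE]
  have hv0 : v 0 = VXE u θ := by simp [hv]
  have hv1 : v 1 = VYE u θ := by simp [hv]
  -- the point is on the level `ν − μ` of `e_K`, inside the tube
  have hlev : frameLevel μ K (WithLp.toLp 2 p) = ν - μ := by
    rw [frameLevel_toLp, frameShift_toLp, ← hroot θ]
  have htube : |frameLevel μ K (WithLp.toLp 2 p)| < r₀ := by rw [hlev]; exact hν
  -- tangency
  have htan : inner ℝ (gradient (frameLevel μ K) (WithLp.toLp 2 p)) (WithLp.toLp 2 v) = 0 := by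
    rw [inner_gradient_left, fderiv_frameLevel_toLp, hp0, hp1, hv0, hv1]
    have h := levelIdentity_one hδ2 hu2 hroot θ
    rw [← hp, ← hv] at h
    linarith
  have hmain := hG.le_hessQuad _ htube _ htan
  -- `‖toLp v‖² = v₀² + v₁²` (also `KLRegimeSplit.norm_toLp_sq` in the counterterm lane)
  have hnorm : ‖(WithLp.toLp 2 v : Momentum)‖ ^ 2 = v 0 ^ 2 + v 1 ^ 2 := by
    rw [EuclideanSpace.norm_eq, Real.sq_sqrt (Finset.sum_nonneg fun i _ => sq_nonneg _), Fin.sum_univ_two]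
    simp only [Real.norm_eq_abs, sq_abs]
  rw [hnorm, hessQuad_frameLevel_toLp, hp0, hp1, hv0, hv1] at hmain
  exact hmain

/-! ## §3 The frame-uniform Gauss-map rate of the frame's Fermi curve -/

section Root

variable {a b : ℝ} (B : BandBounds a b) {K : TrigPolyC4v} {κ₀ κ₁ ν : ℝ}
  (hδ : ∀ k : Fin 2 → ℝ, (∀ i, |k i| ≤ π) → |(fun k : Fin 2 → ℝ => -K.eval k) k| ≤ κ₀) (hlo : a ≤ ν - κ₀) (hhi : ν + κ₀ ≤ b)
  (hκ : ∀ k : Fin 2 → ℝ, (∀ i, |k i| ≤ π) → ‖fderiv ℝ (fun k : Fin 2 → ℝ => -K.eval k) k‖ ≤ κ₁) (hκ₁ : κ₁ < B.Dtmin)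
  {u : ℝ → ℝ} (hu : ∀ θ, IsBandFermiRadius (ν - (fun k : Fin 2 → ℝ => -K.eval k) (u θ • dir θ)) θ (u θ))
  {μ Kc r₀ g₀ w : ℝ} (hG : GeomConstants (frameLevel μ K) Kc r₀ g₀ w) (hν : |ν - μ| < r₀)
include B hδ hlo hhi hκ hκ₁ hu hG hν

/-- **Frame-uniform Gauss-map rate**: for a root selection `u` of the frame curve `{ε₀ + δ_K = ν}` (only the C⁰/C¹ sizes `κ₀`, `κ₁ < Dt_min` of `δ_K` enter)
and `GeomConstants (frameLevel μ K) Kc r₀ g₀ w` with `|ν − μ| < r₀`: `α′(θ) ≥ u_min·w/(4 + κ₁)` at every angle. For `FrameOK` (i) this is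
`u_min·(3/200)/(4 + κ₁)`, the same for every admissible frame. [cite: BenfattoGiulianiMastropietro2003, §7.1 (A1.10)] -/
theorem deriv_normalAngleFn_ge_of_geomConstants (θ : ℝ) :
    B.umin * w / (4 + κ₁) ≤ deriv (fun ϑ => ϑ - Real.arctan (deriv u ϑ / u ϑ)) θ := by
  have hδs : ContDiff ℝ 2 (fun k : Fin 2 → ℝ => -K.eval k) := contDiff_frameShift_toLp K
  have h2ne : (2 : WithTop ℕ∞) ≠ 0 := by norm_num
  have hu2 : ContDiff ℝ 2 u := contDiff_of_isRoot B hδs h2ne hδ hlo hhi hκ hκ₁ hu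
  have hroot : ∀ ϑ, sqDispersion (u ϑ • dir ϑ) + -K.eval (u ϑ • dir ϑ) = ν := fun ϑ =>
    ((isBandFermiRadius_shifted_iff (fun k : Fin 2 → ℝ => -K.eval k) ν ϑ (u ϑ)).1 (hu ϑ)).2
  exact deriv_normalAngleFn_ge_of_hessFloor B hδs hδ hlo hhi hκ hκ₁ hu hG.wmin_pos.le θ
    (hessFloor_of_geomConstants hG hu2 hroot hν θ)

/-- **Frame-uniform expanding Gauss map** — the `BandBounds.gauss` field of the frame's Fermi curve: `(u_min·w/(4 + κ₁))·|θ − θ′| ≤ |α(θ) − α(θ′)|`.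
[cite: BenfattoGiulianiMastropietro2003, §7.1 Lemma 7.1 (A1.9)] -/
theorem normalAngleFn_expand_of_geomConstants (θ θ' : ℝ) :
    B.umin * w / (4 + κ₁) * |θ - θ'| ≤ |(θ - Real.arctan (deriv u θ / u θ)) - (θ' - Real.arctan (deriv u θ' / u θ'))| := by
  have hδs : ContDiff ℝ 2 (fun k : Fin 2 → ℝ => -K.eval k) := contDiff_frameShift_toLp K
  have h2ne : (2 : WithTop ℕ∞) ≠ 0 := by norm_num
  have hu2 : ContDiff ℝ 2 u := contDiff_of_isRoot B hδs h2ne hδ hlo hhi hκ hκ₁ hu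
  have hroot : ∀ ϑ, sqDispersion (u ϑ • dir ϑ) + -K.eval (u ϑ • dir ϑ) = ν := fun ϑ =>
    ((isBandFermiRadius_shifted_iff (fun k : Fin 2 → ℝ => -K.eval k) ν ϑ (u ϑ)).1 (hu ϑ)).2
  exact normalAngleFn_expand_of_hessFloor B hδs hδ hlo hhi hκ hκ₁ hu hG.wmin_pos.le
    (fun z => hessFloor_of_geomConstants hG hu2 hroot hν z) θ θ'

/-- Oriented form: the normal angle of the frame curve increases at rate `≥ u_min·w/(4 + κ₁)`. [cite: BenfattoGiulianiMastropietro2003, §7.1 Lemma 7.1 (A1.9)] -/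
theorem normalAngleFn_sub_ge_of_geomConstants {θ θ' : ℝ} (hθ : θ ≤ θ') :
    B.umin * w / (4 + κ₁) * (θ' - θ) ≤ (θ' - Real.arctan (deriv u θ' / u θ')) - (θ - Real.arctan (deriv u θ / u θ)) := by
  have hδs : ContDiff ℝ 2 (fun k : Fin 2 → ℝ => -K.eval k) := contDiff_frameShift_toLp K
  have h2ne : (2 : WithTop ℕ∞) ≠ 0 := by norm_num
  have hu2 : ContDiff ℝ 2 u := contDiff_of_isRoot B hδs h2ne hδ hlo hhi hκ hκ₁ hu
  have hroot : ∀ ϑ, sqDispersion (u ϑ • dir ϑ) + -K.eval (u ϑ • dir ϑ) = ν := fun ϑ =>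
    ((isBandFermiRadius_shifted_iff (fun k : Fin 2 → ℝ => -K.eval k) ν ϑ (u ϑ)).1 (hu ϑ)).2
  exact normalAngleFn_sub_ge_of_hessFloor B hδs hδ hlo hhi hκ hκ₁ hu hG.wmin_pos.le
    (fun z => hessFloor_of_geomConstants hG hu2 hroot hν z) hθ

end Root

end Summit.HubbardSuperconductivity.HubbardSuperconductivity.Theorems.PerturbedFermiCurve

end
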